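import Mathlib
import Literature.Analysis.FluidPDE.Tao2016AveragedNS.ShiftSetCascadeFlows
import Literature.Analysis.FluidPDE.Tao2016AveragedNS.ShiftSetCascadeFlux
import Summits.NavierStokesRegularity.NavierStokesRegularity.Theorems.TaoLadderRungTwoFlatCertificateGlueSectionReadVectorOn
import HarnessLib

/-!
# Certificate glue on a shift set `𝕊`, XXXIV: THE READOUT CLAUSES ON THE SECTION-NODE BOX — exact rational twins `xsQ` / `rsQ` of the section-node
  centre `x*` and box radius `R* = Σ_col |C*|·r + E*` (glue XXX), the Boolean test `checkReadout` of the five readout clauses of glue IV / XXII / XXXI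
  (`floor (1+ε₀)^{-θ₀} ≤ a`, `slack (1+σ)a ≤ |y_{i₀,1}|`, `matching w_k |y_{i,1+k}/a − z'_{i,k}| ≤ ρ r`, `top`, `exit |y_{i,−Kb}| ≤ a·Zx`) with branch
  constants `a`, `z'`, and its soundness `read_of_checkReadout`: every state whose weighted coordinates lie in the box `B* = [x* ± R*]` satisfies the
  `∃ a z'` readout clause (helper for items stmt-NavierStokesRegularity-22987 `FlatGapCertificatesV2` (crux K_A♭ of route TaoLadderRungTwoFlat) and
  stmt-24295 K_A₂(64); cell harvest/h2-tao-ladder, p1 g16; g15 HANDOFF (b) «LEMMA XXIV readout on B*»; theory-1 E3 v0.2 clauses floor / slack / top /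
  exit / matching)

`stepRead_readout_of_checks`: `checkGlobal ∧ checkStepV … j ∧ checkSection ∧ checkReadout` ⇒ `StepRead` with EXACTLY the readout property `hread` of
glue XXXI `hland_of_branchMeshes'` (for `sec y := secQ q (pxcoord y)`, `w k := wq k`, `ε₀ := q`, `θ₀ := θn/θd`, `z' := zstate zc`), given `Core z'`.

HONEST FRAMING: Tao-type MODEL lattices (Tao 2016 §4/§6 vocabulary, shift-set parametrised); checker soundness — NO certificate instance exists in the
tree, nothing is certified here, no stub is closed, nothing here is a statement about the Navier–Stokes equations.
-/

-- the sub-problem namespace repeats the summit name by design (D-0017)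
set_option linter.dupNamespace false

namespace Summit.NavierStokesRegularity.NavierStokesRegularity.Theorems

open Set Finset Literature.Analysis.FluidPDE Literature.Analysis.FluidPDE.TaoCascade
open Summit.NavierStokesRegularity.NavierStokesRegularity.Theorems.TaylorModelCert

namespace CertificateGlueOn

variable {m : ℕ} {Kb Ka : ℤ}

/-! ### Exact rational twins of the section-node box -/

/-- Rational `ĝ·v = Σ_j q_j p_j v_j` for a rational vector `v`. [folklore] -/
def gdotQ (n : ℕ) (qz : Array ℤ) (p : Array Dyad) (v : Fin n → ℚ) : ℚ :=
  ∑ j : Fin n, ((qz.getD j 0 : ℤ) : ℚ) * dyadToRat (dgetD p j) * v j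

/-- Rational `sec_q(p) = ½ Σ q_j p_j²`. [folklore] -/
def secQQ (n : ℕ) (qz : Array ℤ) (p : Array Dyad) : ℚ := (1 / 2) * ∑ j : Fin n, ((qz.getD j 0 : ℤ) : ℚ) * dyadToRat (dgetD p j) ^ 2

/-- Rational section-node centre `x*_c = p_c − f_c (sec p − lev)/d̂ + ((x̄−p)_c − f_c ĝ·(x̄−p)/d̂)`. [folklore] -/
def xsQ (n : ℕ) (qz : Array ℤ) (p f xb : Array Dyad) (lev : ℚ) (c : Fin n) : ℚ :=
  dyadToRat (dgetD p c) - dyadToRat (dgetD f c) * (secQQ n qz p - lev) / dQ n qz p f +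
    ((dyadToRat (dgetD xb c) - dyadToRat (dgetD p c)) -
      dyadToRat (dgetD f c) * gdotQ n qz p (fun j => dyadToRat (dgetD xb j) - dyadToRat (dgetD p j)) / dQ n qz p f)

/-- Rational `qmax(W)`. [folklore] -/
def qmaxQ (n : ℕ) (qz : Array ℤ) (W : Array Dyad) : ℚ :=
  max ((1 / 2) * ∑ j : Fin n, max ((qz.getD j 0 : ℤ) : ℚ) 0 * dyadToRat (dgetD W j) ^ 2)
    ((1 / 2) * ∑ j : Fin n, max (-((qz.getD j 0 : ℤ) : ℚ)) 0 * dyadToRat (dgetD W j) ^ 2)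

/-- Rational section-node remainder `E*_c`. [folklore] -/
def secErrQ (n : ℕ) (qz : Array ℤ) (p κ E Φ W : Array Dyad) (Δ : ℚ) (c : Fin n) : ℚ :=
  (dyadToRat (dgetD E c) + dyadToRat (dgetD κ c) * ∑ j : Fin n, |((qz.getD j 0 : ℤ) : ℚ) * dyadToRat (dgetD p j)| * dyadToRat (dgetD E j)) +
    Δ * (dyadToRat (dgetD Φ c) + dyadToRat (dgetD κ c) * ∑ j : Fin n, |((qz.getD j 0 : ℤ) : ℚ) * dyadToRat (dgetD p j)| * dyadToRat (dgetD Φ j)) +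
    dyadToRat (dgetD κ c) * qmaxQ n qz W

/-- Rational column pairings `ĝ·C_col`. [folklore] -/
def gcolQ (n : ℕ) (qz : Array ℤ) (p : Array Dyad) (C : Array (Array Dyad)) (col : Fin n) : ℚ :=
  gdotQ n qz p fun j => dyadToRat (dmgetD C j col)

/-- Rational section-node box radius `R*_c = Σ_col |C_{c,col} − f_c (ĝ·C_col)/d̂|·r_col + E*_c`, with the column pairings passed in. [folklore] -/
def rsQ (n : ℕ) (qz : Array ℤ) (p f κ E Φ W r : Array Dyad) (C : Array (Array Dyad)) (g : Fin n → ℚ) (Δ : ℚ) (c : Fin n) : ℚ :=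
  (∑ col : Fin n, |dyadToRat (dmgetD C c col) - dyadToRat (dgetD f c) * g col / dQ n qz p f| * dyadToRat (dgetD r col)) +
    secErrQ n qz p κ E Φ W Δ c

/-- `xsQ` casts to `secCentre`. [folklore] -/
theorem cast_xsQ (n : ℕ) (qz : Array ℤ) (p f xb : Array Dyad) (lev : ℚ) (c : Fin n) :
    ((xsQ n qz p f xb lev c : ℚ) : ℝ) =
      secCentre (qvec (n := n) qz) (dvec (n := n) p) (dvec (n := n) f) (dvec (n := n) xb) (lev : ℝ) c := by
  simp only [xsQ, secQQ, gdotQ, secCentre, secProj, secQ, secPair, secGrad, qvec, dvec, ← cast_dQ, Pi.sub_apply]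
  push_cast
  simp only [cast_dyadToRat]

/-- `qmaxQ` casts to `secQmax`. [folklore] -/
theorem cast_qmaxQ (n : ℕ) (qz : Array ℤ) (W : Array Dyad) :
    ((qmaxQ n qz W : ℚ) : ℝ) = secQmax (qvec (n := n) qz) (dvec (n := n) W) := by
  simp only [qmaxQ, secQmax, qvec, dvec]
  push_cast
  simp only [cast_dyadToRat]

/-- `secErrQ` casts to `secErr`. [folklore] -/
theorem cast_secErrQ (n : ℕ) (qz : Array ℤ) (p κ E Φ W : Array Dyad) (Δ : ℚ) (c : Fin n) :
    ((secErrQ n qz p κ E Φ W Δ c : ℚ) : ℝ) =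
      secErr (qvec (n := n) qz) (dvec (n := n) p) (dvec (n := n) κ) (dvec (n := n) E) (dvec (n := n) Φ) (Δ : ℝ)
        (secQmax (qvec (n := n) qz) (dvec (n := n) W)) c := by
  rw [← cast_qmaxQ]
  simp only [secErrQ, secErr, secGrad, qvec, dvec]
  push_cast
  simp only [cast_dyadToRat]

/-- `rsQ` (with the true column pairings) casts to `Σ_col |C*_{c,col}|·r_col + E*_c`. [folklore] -/
theorem cast_rsQ (n : ℕ) (qz : Array ℤ) (p f κ E Φ W r : Array Dyad) (C : Array (Array Dyad)) (Δ : ℚ) (c : Fin n) :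
    ((rsQ n qz p f κ E Φ W r C (gcolQ n qz p C) Δ c : ℚ) : ℝ) =
      ∑ col, |secFrame (qvec (n := n) qz) (dvec (n := n) p) (dvec (n := n) f) (dmat (n := n) C) c col| * dvec (n := n) r col +
        secErr (qvec (n := n) qz) (dvec (n := n) p) (dvec (n := n) κ) (dvec (n := n) E) (dvec (n := n) Φ) (Δ : ℝ)
          (secQmax (qvec (n := n) qz) (dvec (n := n) W)) c := by
  rw [← cast_secErrQ]
  simp only [rsQ, gcolQ, gdotQ, secFrame, secGrad, qvec, dvec, dmat, ← cast_dQ]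
  push_cast
  simp only [cast_dyadToRat]

/-! ### The branch readout constants and the renormalised reference state -/

/-- The reference state `z'` of a landing branch from a dyadic window table (zero off the window). [folklore] -/
noncomputable def zstate (Kb Ka : ℤ) (zc : Array Dyad) : Fin m → ℤ → ℝ :=
  fun i k => if h : -Kb ≤ k ∧ k ≤ Ka then (dgetD zc (idxOf Kb Ka i k h)).toReal else 0

/-- **The readout test** on a box `[XS ± RS]` (weighted coordinates): floor `0 < a ∧ 1 ≤ a^θd (1+q)^θn`, slack `(1+σ)a ≤ ω_{i₀,1}(|XS| − RS)` at `idx(i₀,1)`,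
matching `w_k (|ω XS/a − z'| + ω RS/a) ≤ ρ r` for `−Kb ≤ k ≤ Ka − 1` (at `idx(i, 1+k)` against `zc` at `idx(i,k)`), top `w_Ka (Et/a + |z'_{i,Ka}|) ≤ ρ r`,
exit `ω (|XS| + RS) ≤ a Zx` at `idx(i, −Kb)`, and `0 ≤ w_k` on the window. [folklore] -/
def checkReadout (m : ℕ) (Kb Ka : ℤ) (ωq : Fin m → ℤ → ℚ) (i₀ : Fin m) (q σ a ρ r Zx Et : ℚ) (θn θd : ℕ) (wq : ℤ → ℚ) (zc : Array Dyad)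
    (XS RS : Array ℚ) : Bool :=
  let W := winLen Kb Ka
  let ix : Fin m → ℤ → ℕ := fun i k => (k + Kb).toNat + W * i.val
  decide (0 < θd) && decide (0 < a) && decide (1 ≤ a ^ θd * (1 + q) ^ θn) && decide (-Kb ≤ 1 ∧ 1 ≤ Ka) &&
  (decide (RS.getD (ix i₀ 1) 0 ≤ |XS.getD (ix i₀ 1) 0|) &&
    decide ((1 + σ) * a ≤ ωq i₀ 1 * (|XS.getD (ix i₀ 1) 0| - RS.getD (ix i₀ 1) 0))) &&
  ((List.finRange m).all fun i => (List.range W).all fun cc =>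
    let k : ℤ := (cc : ℤ) - Kb
    decide (0 ≤ wq k) &&
    (decide (Ka < k + 1) ||
      decide (wq k * (|ωq i (k + 1) * XS.getD (ix i (k + 1)) 0 / a - dyadToRat (dgetD zc (ix i k))| +
        ωq i (k + 1) * RS.getD (ix i (k + 1)) 0 / a) ≤ ρ * r))) &&
  ((List.finRange m).all fun i =>
    decide (wq Ka * (Et / a + |dyadToRat (dgetD zc (ix i Ka))|) ≤ ρ * r) &&
    decide (ωq i (-Kb) * (|XS.getD (ix i (-Kb)) 0| + RS.getD (ix i (-Kb)) 0) ≤ a * Zx))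

variable {ωq : Fin m → ℤ → ℚ}

/-- The floor clause from the integer-power test: `0 < a`, `1 ≤ a^θd (1+q)^θn`, `0 < 1+q`, `0 < θd` ⇒ `(1+q)^{−θn/θd} ≤ a`. [folklore] -/
theorem floor_of_pow_test {q a : ℚ} {θn θd : ℕ} (hq : 0 < 1 + (q : ℝ)) (hθd : 0 < θd) (ha : 0 < a) (h : 1 ≤ a ^ θd * (1 + q) ^ θn) :
    (1 + (q : ℝ)) ^ (-((θn : ℝ) / (θd : ℝ))) ≤ (a : ℝ) := by
  have haR : (0 : ℝ) < (a : ℝ) := by exact_mod_cast ha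
  have hθdR : (0 : ℝ) < (θd : ℝ) := by exact_mod_cast hθd
  set B : ℝ := 1 + (q : ℝ) with hB
  have hR : (1 : ℝ) ≤ (a : ℝ) ^ θd * B ^ θn := by
    have := (Rat.cast_le (K := ℝ)).mpr h
    push_cast at this
    simpa [hB] using this
  -- `B^(-θn) ≤ a^θd`
  have h1 : B ^ (-(θn : ℝ)) ≤ (a : ℝ) ^ (θd : ℝ) := by
    rw [Real.rpow_neg hq.le, Real.rpow_natCast, Real.rpow_natCast]
    rw [inv_le_iff_one_le_mul₀ (pow_pos hq θn)]
    linarith [mul_comm ((a : ℝ) ^ θd) (B ^ θn)]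
  -- take the `1/θd`-th power
  have h2 := Real.rpow_le_rpow (Real.rpow_nonneg hq.le _) h1 (by positivity : (0 : ℝ) ≤ 1 / (θd : ℝ))
  rw [← Real.rpow_mul hq.le, ← Real.rpow_mul haR.le, mul_one_div_cancel hθdR.ne', Real.rpow_one] at h2
  have e : -(θn : ℝ) * (1 / (θd : ℝ)) = -((θn : ℝ) / (θd : ℝ)) := by ring
  rwa [e] at h2

/-- **SOUNDNESS OF THE READOUT TEST**: every state whose weighted coordinates lie in `[XS ± RS]` satisfies the readout clause of glue XXXI
`hland_of_branchMeshes'` with `a`, `z' = zstate zc`, `w = wq`, `ε₀ = q`, `θ₀ = θn/θd`, given `Core z'`. [cite: Tao2016AveragedNS, §6.3–6.4 Props. 6.4–6.5 (statement shape; the readout clauses); cell certificate format, readout checker] -/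
theorem read_of_checkReadout (hKb : 0 ≤ Kb) (hKa : 1 ≤ Ka) (hω : ∀ i k, 0 < ωq i k) {Core : (Fin m → ℤ → ℝ) → Prop}
    {i₀ : Fin m} {q σ a ρ r Zx Et : ℚ} {θn θd : ℕ} {wq : ℤ → ℚ} {zc : Array Dyad} {XS RS : Array ℚ} (hq : 0 < 1 + (q : ℝ))
    (hc : checkReadout m Kb Ka ωq i₀ q σ a ρ r Zx Et θn θd wq zc XS RS = true) (hcore : Core (zstate (m := m) Kb Ka zc))
    {y : Fin m → ℤ → ℝ}
    (hy : ∀ c : Fin (m * winLen Kb Ka), |pxcoord Kb Ka (fun i k => (ωq i k : ℝ)) y c - (XS.getD c 0 : ℝ)| ≤ (RS.getD c 0 : ℝ)) :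
    ∃ (a' : ℝ) (z' : Fin m → ℤ → ℝ), 0 < a' ∧ (1 + (q : ℝ)) ^ (-((θn : ℝ) / (θd : ℝ))) ≤ a' ∧ (1 + (σ : ℝ)) * a' ≤ |y i₀ 1| ∧ Core z' ∧
      (∀ i k, -Kb ≤ k → k + 1 ≤ Ka → (wq k : ℝ) * |y i (1 + k) / a' - z' i k| ≤ (ρ : ℝ) * (r : ℝ)) ∧
      (∀ (i : Fin m) (v : ℝ), |v| ≤ (Et : ℝ) → (wq Ka : ℝ) * |v / a' - z' i Ka| ≤ (ρ : ℝ) * (r : ℝ)) ∧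
      (∀ i, |y i (-Kb)| ≤ a' * (Zx : ℝ)) := by
  have hKK : 0 ≤ Ka + Kb + 1 := by omega
  simp only [checkReadout, Bool.and_eq_true, Bool.or_eq_true, decide_eq_true_eq, List.all_eq_true, List.mem_finRange, List.mem_range,
    true_implies] at hc
  obtain ⟨⟨⟨⟨⟨⟨hθd, ha⟩, hfl⟩, h1w⟩, ⟨hsl1, hsl2⟩⟩, hmatch⟩, htopexit⟩ := hc
  have haR : (0 : ℝ) < (a : ℝ) := by exact_mod_cast ha
  -- the window value at `(i, k)` from the box
  have hval : ∀ (i : Fin m) (k : ℤ) (hw : -Kb ≤ k ∧ k ≤ Ka),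
      y i k = (ωq i k : ℝ) * pxcoord Kb Ka (fun i k => (ωq i k : ℝ)) y (idxOf Kb Ka i k hw) ∧
      |pxcoord Kb Ka (fun i k => (ωq i k : ℝ)) y (idxOf Kb Ka i k hw) - (XS.getD ((k + Kb).toNat + winLen Kb Ka * i.val) 0 : ℝ)| ≤
        (RS.getD ((k + Kb).toNat + winLen Kb Ka * i.val) 0 : ℝ) := by
    intro i k hw
    have hωk : (0 : ℝ) < (ωq i k : ℝ) := by exact_mod_cast hω i k
    refine ⟨?_, ?_⟩
    · rw [pxcoord_idxOf y i hw]; field_simp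
    · have := hy (idxOf Kb Ka i k hw); rwa [idxOf_val i hw] at this
  -- generic consequence: `|ω·Y| ≤ ω (|XS| + RS)` and `ω (|XS| − RS) ≤ |ω Y|`
  have hbounds : ∀ (i : Fin m) (k : ℤ) (hw : -Kb ≤ k ∧ k ≤ Ka),
      |y i k| ≤ (ωq i k : ℝ) * (|(XS.getD ((k + Kb).toNat + winLen Kb Ka * i.val) 0 : ℝ)| +
        (RS.getD ((k + Kb).toNat + winLen Kb Ka * i.val) 0 : ℝ)) ∧
      (ωq i k : ℝ) * (|(XS.getD ((k + Kb).toNat + winLen Kb Ka * i.val) 0 : ℝ)| -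
        (RS.getD ((k + Kb).toNat + winLen Kb Ka * i.val) 0 : ℝ)) ≤ |y i k| := by
    intro i k hw
    obtain ⟨hv, hb⟩ := hval i k hw
    have hωk : (0 : ℝ) < (ωq i k : ℝ) := by exact_mod_cast hω i k
    set Y := pxcoord Kb Ka (fun i k => (ωq i k : ℝ)) y (idxOf Kb Ka i k hw)
    set X : ℝ := (XS.getD ((k + Kb).toNat + winLen Kb Ka * i.val) 0 : ℝ)
    set R : ℝ := (RS.getD ((k + Kb).toNat + winLen Kb Ka * i.val) 0 : ℝ)
    rw [hv, abs_mul, abs_of_pos hωk]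
    have h1 : |Y| ≤ |X| + R := by
      have := abs_add_le (Y - X) X; rw [sub_add_cancel] at this; linarith [abs_sub_comm Y X]
    have h2 : |X| - R ≤ |Y| := by
      have := abs_sub_abs_le_abs_sub X Y; rw [abs_sub_comm X Y] at this; linarith
    exact ⟨mul_le_mul_of_nonneg_left h1 hωk.le, mul_le_mul_of_nonneg_left h2 hωk.le⟩
  refine ⟨(a : ℝ), zstate Kb Ka zc, haR, floor_of_pow_test hq hθd ha hfl, ?_, hcore, fun i k hk1 hk2 => ?_, fun i v hv => ?_, fun i => ?_⟩
  · -- slack at `(i₀, 1)`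
    have h := (hbounds i₀ 1 h1w).2
    have hsl2r := (Rat.cast_le (K := ℝ)).mpr hsl2
    push_cast at hsl2r
    exact hsl2r.trans h
  · -- matching at `(i, 1+k)` against `z'_{i,k}`
    have hw1 : -Kb ≤ 1 + k ∧ 1 + k ≤ Ka := ⟨by omega, by omega⟩
    have hw0 : -Kb ≤ k ∧ k ≤ Ka := ⟨hk1, by omega⟩
    have hcc : (k + Kb).toNat < winLen Kb Ka := by unfold winLen; rw [Int.toNat_lt_toNat (by omega)]; omega
    obtain ⟨hwk, hor⟩ := hmatch i (k + Kb).toNat hcc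
    rw [Int.toNat_of_nonneg (by omega), show k + Kb - Kb = k by ring] at hwk hor
    rcases hor with hbad | hm
    · exact absurd hbad (by omega)
    have hwkR : (0 : ℝ) ≤ (wq k : ℝ) := by exact_mod_cast hwk
    obtain ⟨hv, hb⟩ := hval i (1 + k) hw1
    have hωk : (0 : ℝ) < (ωq i (1 + k) : ℝ) := by exact_mod_cast hω i (1 + k)
    have hz : zstate Kb Ka zc i k = (dgetD zc (idxOf Kb Ka i k hw0)).toReal := by unfold zstate; rw [dif_pos hw0]
    rw [hz, idxOf_val i hw0, hv]
    set Y := pxcoord Kb Ka (fun i k => (ωq i k : ℝ)) y (idxOf Kb Ka i (1 + k) hw1)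
    have e14 : (1 + k + Kb).toNat = (k + 1 + Kb).toNat := by ring_nf
    rw [e14] at hb
    set X : ℝ := (XS.getD ((k + 1 + Kb).toNat + winLen Kb Ka * i.val) 0 : ℝ)
    set R : ℝ := (RS.getD ((k + 1 + Kb).toNat + winLen Kb Ka * i.val) 0 : ℝ)
    set Z : ℝ := (dgetD zc ((k + Kb).toNat + winLen Kb Ka * i.val)).toReal
    have hmR := (Rat.cast_le (K := ℝ)).mpr hm
    simp only [Rat.cast_mul, Rat.cast_add, Rat.cast_abs, Rat.cast_sub, Rat.cast_div, cast_dyadToRat] at hmR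
    have hk1' : (ωq i (k + 1) : ℝ) = (ωq i (1 + k) : ℝ) := by rw [add_comm]
    rw [hk1'] at hmR
    -- `|ω Y / a − Z| ≤ |ω X / a − Z| + ω R / a`
    have htri : |(ωq i (1 + k) : ℝ) * Y / (a : ℝ) - Z| ≤ |(ωq i (1 + k) : ℝ) * X / (a : ℝ) - Z| + (ωq i (1 + k) : ℝ) * R / (a : ℝ) := by
      have hdiff : (ωq i (1 + k) : ℝ) * Y / (a : ℝ) - Z = ((ωq i (1 + k) : ℝ) * X / (a : ℝ) - Z) + (ωq i (1 + k) : ℝ) * (Y - X) / (a : ℝ) := by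
        ring
      rw [hdiff]
      refine (abs_add_le _ _).trans (add_le_add le_rfl ?_)
      rw [abs_div, abs_mul, abs_of_pos hωk, abs_of_pos haR]
      exact div_le_div_of_nonneg_right (mul_le_mul_of_nonneg_left hb hωk.le) haR.le
    calc (wq k : ℝ) * |(ωq i (1 + k) : ℝ) * Y / (a : ℝ) - Z|
        ≤ (wq k : ℝ) * (|(ωq i (1 + k) : ℝ) * X / (a : ℝ) - Z| + (ωq i (1 + k) : ℝ) * R / (a : ℝ)) := mul_le_mul_of_nonneg_left htri hwkR
      _ ≤ (ρ : ℝ) * (r : ℝ) := hmR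
  · -- top
    obtain ⟨htop, -⟩ := htopexit i
    have hwK : -Kb ≤ Ka ∧ Ka ≤ Ka := ⟨by omega, le_rfl⟩
    have hz : zstate Kb Ka zc i Ka = (dgetD zc (idxOf Kb Ka i Ka hwK)).toReal := by unfold zstate; rw [dif_pos hwK]
    rw [hz, idxOf_val i hwK]
    have htopR := (Rat.cast_le (K := ℝ)).mpr htop
    simp only [Rat.cast_mul, Rat.cast_add, Rat.cast_abs, Rat.cast_div, cast_dyadToRat] at htopR
    -- `0 ≤ wq Ka` from the window test at `k = Ka`
    have hccK : (Ka + Kb).toNat < winLen Kb Ka := by unfold winLen; rw [Int.toNat_lt_toNat (by omega)]; omega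
    obtain ⟨hwK0, -⟩ := hmatch i (Ka + Kb).toNat hccK
    rw [Int.toNat_of_nonneg (by omega), show Ka + Kb - Kb = Ka by ring] at hwK0
    have hwKR : (0 : ℝ) ≤ (wq Ka : ℝ) := by exact_mod_cast hwK0
    set Z : ℝ := (dgetD zc ((Ka + Kb).toNat + winLen Kb Ka * i.val)).toReal
    have htri : |v / (a : ℝ) - Z| ≤ (Et : ℝ) / (a : ℝ) + |Z| := by
      refine (abs_sub _ _).trans (add_le_add ?_ le_rfl)
      rw [abs_div, abs_of_pos haR]; exact div_le_div_of_nonneg_right hv haR.le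
    exact (mul_le_mul_of_nonneg_left htri hwKR).trans htopR
  · -- exit at `(i, −Kb)`
    obtain ⟨-, hex⟩ := htopexit i
    have hwB : -Kb ≤ -Kb ∧ -Kb ≤ Ka := ⟨le_rfl, by omega⟩
    have h := (hbounds i (-Kb) hwB).1
    have hexR := (Rat.cast_le (K := ℝ)).mpr hex
    simp only [Rat.cast_mul, Rat.cast_add, Rat.cast_abs] at hexR
    exact h.trans hexR

/-! ### Composition with the section step: `StepRead` with the readout clause -/

variable {𝕊 : Finset (ℤ × ℤ × ℤ)} {ε₀ : ℝ} {α : Fin m → Fin m → Fin m → ℤ × ℤ × ℤ → ℝ} {Eb Et : ℝ} {M : ℤ → ℝ}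

/-- `StepRead` is monotone in the readout property. [folklore] -/
theorem stepRead_mono {t : ℕ → ℝ} {Node : ℕ → (Fin m → ℤ → ℝ) → Prop} {P P' : (Fin m → ℤ → ℝ) → Prop} {j : ℕ}
    (h : StepRead 𝕊 ε₀ α Kb Ka Eb Et M t Node P j) (hPP' : ∀ y, P y → P' y) : StepRead 𝕊 ε₀ α Kb Ka Eb Et M t Node P' j :=
  fun s S hs0 hs1 hn hrun hM => hPP' _ (h s S hs0 hs1 hn hrun hM)

/-- The tabulated section-node centre of record `j`. [folklore] -/
def xsArr (n : ℕ) (qz : Array ℤ) (sr : SecRec) (x : Array Dyad) (lev : ℚ) : Array ℚ :=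
  Array.ofFn fun c : Fin n => xsQ n qz sr.p sr.f x lev c

/-- The tabulated section-node box radius of record `j`. [folklore] -/
def rsArr (n : ℕ) (qz : Array ℤ) (sr : SecRec) (E r : Array Dyad) (C : Array (Array Dyad)) (Δ : ℚ) : Array ℚ :=
  let g : Array ℚ := Array.ofFn fun col : Fin n => gcolQ n qz sr.p C col
  Array.ofFn fun c : Fin n => rsQ n qz sr.p sr.f sr.κ E sr.Φ sr.W r C (fun col => g.getD col 0) Δ c

/-- Reading the tables. [folklore] -/
theorem getD_ofFn {n : ℕ} (f : Fin n → ℚ) (c : Fin n) : (Array.ofFn f).getD c 0 = f c := by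
  simp [Array.getD, Array.size_ofFn, Array.getElem_ofFn]

/-- **`StepRead` WITH THE READOUT CLAUSE FROM THE BOOLEANS**: `checkGlobal`, `checkStepV … j`, `checkSection` and `checkReadout` on the tabulated
section-node box ⇒ `StepRead` with exactly the readout property `hread` of glue XXXI `hland_of_branchMeshes'` (`sec y := secQ q (pxcoord y)`,
`w := wq`, `ε₀ := q`, `θ₀ := θn/θd`), given `Core (zstate zc)`. [cite: Tao2016AveragedNS, §6.3–6.4 Props. 6.4–6.5 (statement shape; the readout clauses); cell certificate format, readout checker] -/
theorem stepRead_readout_of_checks (hKb : 0 ≤ Kb) (hKa : 1 ≤ Ka) {shifts : List (ℤ × ℤ × ℤ)} (hnd : shifts.Nodup)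
    (h𝕊 : IsNearestNeighbourSet shifts.toFinset) {q : ℚ} (hq : 0 < 1 + (q : ℝ))
    {αq : Fin m → Fin m → Fin m → ℤ × ℤ × ℤ → ℚ} (hω : ∀ i k, 0 < ωq i k)
    {prec p kexp nexp : ℕ} {Sp Sm : IntervalD} {bD : Dyad} {Eb Et lev : ℚ} {M : ℤ → ℝ} {rec : ℕ → VRec}
    {qz : Array ℤ} {sr : SecRec} {j : ℕ} {Core : (Fin m → ℤ → ℝ) → Prop}
    {i₀ : Fin m} {σ a ρ r Zx Et' : ℚ} {θn θd : ℕ} {wq : ℤ → ℚ} {zc : Array Dyad}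
    (hg : checkGlobal m Kb Ka prec shifts αq ωq q Sp Sm bD = true)
    (hs : checkStepV m Kb Ka prec p kexp nexp shifts αq ωq Sp Sm bD Eb Et rec j = true)
    (hsec : checkSection m Kb Ka prec shifts (coefBoxOf prec αq ωq Sp Sm) qz (rec j).lo (rec j).hi (rec j).δ sr = true)
    (hread : checkReadout m Kb Ka ωq i₀ q σ a ρ r Zx Et' θn θd wq zc (xsArr (m * winLen Kb Ka) qz sr (rec j).x lev)
      (rsArr (m * winLen Kb Ka) qz sr (rec j).E (rec j).r (rec j).C (rec j).h) = true)
    (hcore : Core (zstate (m := m) Kb Ka zc)) :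
    StepRead shifts.toFinset (q : ℝ) (fun i₁ i₂ i μ => (αq i₁ i₂ i μ : ℝ)) Kb Ka (Eb : ℝ) (Et : ℝ) M (tOfV rec) (nodeOfV Kb Ka ωq rec)
      (fun y => secQ (qvec (n := m * winLen Kb Ka) qz) (pxcoord Kb Ka (fun i k => (ωq i k : ℝ)) y) = (lev : ℝ) →
        ∃ (a' : ℝ) (z' : Fin m → ℤ → ℝ), 0 < a' ∧ (1 + (q : ℝ)) ^ (-((θn : ℝ) / (θd : ℝ))) ≤ a' ∧
          (1 + (σ : ℝ)) * a' ≤ |y i₀ 1| ∧ Core z' ∧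
          (∀ i k, -Kb ≤ k → k + 1 ≤ Ka → (wq k : ℝ) * |y i (1 + k) / a' - z' i k| ≤ (ρ : ℝ) * (r : ℝ)) ∧
          (∀ (i : Fin m) (v : ℝ), |v| ≤ (Et' : ℝ) → (wq Ka : ℝ) * |v / a' - z' i Ka| ≤ (ρ : ℝ) * (r : ℝ)) ∧
          (∀ i, |y i (-Kb)| ≤ a' * (Zx : ℝ))) j := by
  have hSR := stepRead_of_checksV (M := M) (lev := lev) hKb hKa hnd h𝕊 hω hg hs hsec
  refine stepRead_mono hSR fun y hP hlev => ?_
  have hbox := hP hlev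
  refine read_of_checkReadout hKb hKa hω hq hread hcore fun c => ?_
  have h1 := hbox c
  have hX : ((xsArr (m * winLen Kb Ka) qz sr (rec j).x lev).getD c 0 : ℝ) =
      secCentre (qvec (n := m * winLen Kb Ka) qz) (dvec (n := m * winLen Kb Ka) sr.p) (dvec (n := m * winLen Kb Ka) sr.f)
        (dvec (n := m * winLen Kb Ka) (rec j).x) (lev : ℝ) c := by
    unfold xsArr; rw [getD_ofFn, cast_xsQ]
  have hR : ((rsArr (m * winLen Kb Ka) qz sr (rec j).E (rec j).r (rec j).C (rec j).h).getD c 0 : ℝ) =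
      ∑ col, |secFrame (qvec (n := m * winLen Kb Ka) qz) (dvec (n := m * winLen Kb Ka) sr.p) (dvec (n := m * winLen Kb Ka) sr.f)
          (dmat (n := m * winLen Kb Ka) (rec j).C) c col| * dvec (n := m * winLen Kb Ka) (rec j).r col +
        secErr (qvec (n := m * winLen Kb Ka) qz) (dvec (n := m * winLen Kb Ka) sr.p) (dvec (n := m * winLen Kb Ka) sr.κ)
          (dvec (n := m * winLen Kb Ka) (rec j).E) (dvec (n := m * winLen Kb Ka) sr.Φ) ((rec j).h : ℝ)
          (secQmax (qvec (n := m * winLen Kb Ka) qz) (dvec (n := m * winLen Kb Ka) sr.W)) c := by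
    unfold rsArr
    rw [getD_ofFn, ← cast_rsQ]
    congr 1
    refine congrArg (fun g => rsQ (m * winLen Kb Ka) qz sr.p sr.f sr.κ (rec j).E sr.Φ sr.W (rec j).r (rec j).C g (rec j).h c) ?_
    funext col
    exact getD_ofFn _ col
  rw [hX, hR]
  exact h1

end CertificateGlueOn

end Summit.NavierStokesRegularity.NavierStokesRegularity.Theorems
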